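import Summits.Ventures.PercRepro.SixFourResidueThreeBetaCounts
import Summits.Ventures.PercRepro.SixFourResidueBigPlane

/-!
# `PlaneAddTwoFour` — Theorem 21.6 at `t = 4` for EVERY plane size, part 1: the additive bound (p1, gen 7 — §21.6, §21.18.3 (β) `k = 2`)

For `G = τ ⊔ {a, a′}` with `τ = P₀ ∩ G` a rank-`3` plane trace of `p` points and lines of sizes `m_λ` (`2`-point lines
included), the share / demand bounds of `SixFourResidueTwoPointsB/C` (`J_four_ge_shares`, `share_sum_ge`) and the refined
demand count of `SixFourResidueThreeBetaCounts` (`dem3_sum_add_collSum_le`, with `dem = dem3` pointwise) give, with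
every count written as a constant plus a sum over the lines (`Tcnt_eq_all`, `D3cnt_eq_all`, `LPcnt_le_all`,
`card_small_eq_all`):

  `30·J₄(G) ≥ A30 p + Σ_λ B30 p m_λ`     (`J_four_ge_additive`)

with `A30 p = 39·C(p,3) + 120·δ(p) − 72·Σ_{3 ≤ j ≤ p−3} C(p,j)` and
`B30 p m = −39·C(m,3) − 120·δ(m) − 50·ε(m)·(p − m) + 72·(Σ_{3 ≤ j ≤ p−3} C(m,j) + collCount m)` (no size cap anywhere) —
the `t = 4` twin of p2's `J_three_ge_additive₂` (`A20 2 p`, `B20 2 p m`; only the `dem₃`-type demand survives at `t = 4`,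
the `(β)` sets with collinear `B″` being demand-free).  `SixFourResidueFourBetaLong.lean` turns it into Theorem 21.6 at `t = 4`
by the one-long-line certificate, `SixFourResidueFourBetaTableA/B.lean` decide the certificates for `4 ≤ p ≤ 100`,
`SixFourResidueFourBetaTail.lean` proves the `p ≥ 101` certificate `(−p·2^h, 1)`, and `SixFourResidueFourBetaHolds.lean`
assembles `planeAddTwoFour_holds : PlaneAddTwoFour`.
-/

namespace PercRepro.SixFour

/-- The constant of the `t = 4` additive bound (`30×`): `39·C(p,3) + 120·δ(p) − 72·smallTot p p 3`. -/
def A30 (p : ℕ) : ℤ := 39 * (p.choose 3 : ℤ) + 120 * (delta p : ℤ) - 72 * (smallTot p p 3 : ℤ)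

/-- The per-line term of the `t = 4` additive bound (`30×`):
`−39·C(m,3) − 120·δ(m) − 50·ε(m)·(p − m) + 72·(smallTot m p 3 + collCount m)`. -/
def B30 (p m : ℕ) : ℤ :=
  -39 * (m.choose 3 : ℤ) - 120 * (delta m : ℤ) - 50 * (eps m : ℤ) * ((p - m : ℕ) : ℤ) +
    72 * ((smallTot m p 3 : ℤ) + (collCount m : ℤ))

open Finset ThmH

variable {α : Type*} [DecidableEq α] {M : Matroid α} [M.Finite] {G : Finset α}

/-! ## The demand at `t = 4` is the demand at `t = 3` -/

/-- `dem = dem₃` pointwise: `r(τ ∖ B) + 2 ≤ 4 ⟺ r(τ ∖ B) + 1 ≤ 3`. -/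
theorem dem_eq_dem3 (τ B : Finset α) : dem M τ B = dem3 M τ B := by
  unfold dem dem3
  obtain ⟨n, hn, -⟩ := eRk_eq_nat M (τ \ B)
  rw [hn]
  have h1 : ((n : ℕ∞) + 2 ≤ (4 : ℕ∞)) ↔ n ≤ 2 := by
    rw [show ((n : ℕ∞) + 2) = ((n + 2 : ℕ) : ℕ∞) by push_cast; rfl,
      show (4 : ℕ∞) = ((4 : ℕ) : ℕ∞) by rfl, Nat.cast_le]
    omega
  have h2 : ((n : ℕ∞) + 1 ≤ (3 : ℕ∞)) ↔ n ≤ 2 := by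
    rw [show ((n : ℕ∞) + 1) = ((n + 1 : ℕ) : ℕ∞) by push_cast; rfl,
      show (3 : ℕ∞) = ((3 : ℕ) : ℕ∞) by rfl, Nat.cast_le]
    omega
  simp only [h1, h2]

/-- The refined demand count at `t = 4`: `Σ dem + Σ_λ collCount m_λ ≤ #{S ∈ R₃(τ) : |S| + 3 ≤ p}`. -/
theorem dem_sum_add_collSum_le (hs : Simple M) {τ : Finset α} (hτ : τ ⊆ gr M) (hr : M.eRk (τ : Set α) = 3) :
    ∑ S ∈ R3 M τ, dem M τ S + ∑ L ∈ lines M, ((collCount (L ∩ τ).card : ℤ) : ℚ) ≤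
      (((R3 M τ).filter (fun S => S.card + 3 ≤ τ.card)).card : ℚ) := by
  have h := dem3_sum_add_collSum_le hs hτ hr
  simp only [dem_eq_dem3]
  exact h

/-! ## The additive bound -/

section Additive

/-- `Σ_λ B30 p m_λ` split into its line sums. -/
theorem sum_B30 (τ : Finset α) :
    ∑ L ∈ lines M, ((B30 τ.card (L ∩ τ).card : ℤ) : ℚ) =
      -39 * ∑ L ∈ lines M, (((L ∩ τ).card.choose 3 : ℤ) : ℚ) - 120 * ∑ L ∈ lines M, ((delta (L ∩ τ).card : ℤ) : ℚ) -
        50 * ∑ L ∈ lines M, (((eps (L ∩ τ).card : ℤ) * ((τ.card - (L ∩ τ).card : ℕ) : ℤ) : ℤ) : ℚ) +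
        72 * (∑ L ∈ lines M, ((smallTot (L ∩ τ).card τ.card 3 : ℤ) : ℚ) +
          ∑ L ∈ lines M, ((collCount (L ∩ τ).card : ℤ) : ℚ)) := by
  simp only [B30, Finset.mul_sum, ← Finset.sum_add_distrib, ← Finset.sum_sub_distrib]
  refine Finset.sum_congr rfl (fun L _ => ?_)
  push_cast
  ring

variable (hs : Simple M) (hG : G ⊆ gr M) (hr : M.eRk (G : Set α) = 4) {P₀ : Finset α} (hP₀ : P₀ ∈ planes M)
include hs hG hr hP₀

/-- **The additive bound at `t = 4`** (every plane size): `A30 p + Σ_λ B30 p m_λ ≤ 30·J₄(G)` when `G ∖ P₀ = {a, a′}` and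
`τ = P₀ ∩ G` has rank `3`. -/
theorem J_four_ge_additive {a a' : α} (ht : TwoOff M G P₀ a a')
    (hr3 : M.eRk ((P₀ ∩ G : Finset α) : Set α) = 3) :
    ((A30 (P₀ ∩ G).card : ℤ) : ℚ) + ∑ L ∈ lines M, ((B30 (P₀ ∩ G).card (L ∩ (P₀ ∩ G)).card : ℤ) : ℚ) ≤
      30 * J M G 4 := by
  set τ := P₀ ∩ G with hτdef
  have hτ : τ ⊆ gr M := Finset.inter_subset_right.trans hG
  have hshares := J_four_ge_shares ht hG hr hP₀
  rw [← hτdef] at hshares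
  have hsum := share_sum_ge hs hτ
  have hdem := dem_sum_add_collSum_le hs hτ hr3
  have hT := Tcnt_eq_all hs hτ hr3
  have hD := D3cnt_eq_all hs hτ hr3
  have hLP := LPcnt_le_all hs hτ
  have hS := card_small_eq_all hs hτ hr3 3
  have hB := sum_B30 (M := M) τ
  rw [hB]
  have hTq : (Tcnt M τ : ℚ) = (τ.card.choose 3 : ℚ) - ∑ L ∈ lines M, (((L ∩ τ).card.choose 3 : ℤ) : ℚ) := by
    have := congrArg (fun x : ℤ => (x : ℚ)) hT
    push_cast at this ⊢
    linarith
  have hDq : (D3cnt M τ : ℚ) = (delta τ.card : ℚ) - ∑ L ∈ lines M, ((delta (L ∩ τ).card : ℤ) : ℚ) := by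
    have := congrArg (fun x : ℤ => (x : ℚ)) hD
    push_cast at this ⊢
    linarith
  have hLPq : (LPcnt M τ : ℚ) ≤
      ∑ L ∈ lines M, (((eps (L ∩ τ).card : ℤ) * ((τ.card - (L ∩ τ).card : ℕ) : ℤ) : ℤ) : ℚ) := by
    have := (Int.cast_le (R := ℚ)).2 hLP
    push_cast at this ⊢
    exact this
  have hSq : (((R3 M τ).filter (fun S => S.card + 3 ≤ τ.card)).card : ℚ) =
      (smallTot τ.card τ.card 3 : ℚ) - ∑ L ∈ lines M, ((smallTot (L ∩ τ).card τ.card 3 : ℤ) : ℚ) := by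
    have := congrArg (fun x : ℤ => (x : ℚ)) hS
    push_cast at this ⊢
    linarith
  unfold A30
  push_cast at hshares hsum hdem hTq hDq hLPq hSq ⊢
  linarith [hshares, hsum, hdem, hTq, hDq, hLPq, hSq]

end Additive

end PercRepro.SixFour
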